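import Literature.NumberTheory.Automorphic.GaloisActionPlaces
import Literature.NumberTheory.AdelicBaseChange.IntegralClosureLocalization
import Literature.NumberTheory.EllipticCurves.Kato2004.EulerSystemValues
import Literature.NumberTheory.EllipticCurves.DeligneSerreWeightOneIrreducibleKroneckerWeberProofs
import HarnessLib

/-!
# The twist family of a cyclotomic level: existence of the per-level datum `g` of hKatoV2₀ / hKdef₀
# (cell `bsd-addord`, seat w2-acc4 gen 6; crux `KatoKuriharaPortThreeShared` = stmt-BirchSwinnertonDyer-19560;
# `--supports 19560`, helper)

HONEST FRAMING.  TOOL theorems (no definition, no named fact, no instance, no `sorry`); they close nothing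
and book nothing; BSD / 19560 are not proved by this file.

WHAT.  The single-completion shape of the Kato package displayed on the crux's chain (acc5 gen 5's hKdef₀,
kim3 gen 15's hKatoV2₀, binder text `KimAtThreeFineKatoPerFactorPartsSingle` l.104–187) reads every factor
`L_w` of `ℚ₃ ⊗ ℚ(ζ_m)` (`w ∣ 3` a place of the level field `L = ℚ(ζ_m)`) at ONE place `w₀` through a
**twist family**: a function `g : (places of L above v) → Γ_ℚ` with
`σ_{χ_m(g w)} • w = w₀` for every `w`, where `σ_b ∈ Gal(ℚ(ζ_m)/ℚ)` is Kato's `sigma m b` (`σ_b ζ = ζ^b`,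
(5.7.1) p. 157) and `χ_m` the mod-`m` cyclotomic character.  Whoever EXHIBITS that displayed datum
(`∃ w₀ g hg, …`) needs the existence of such a family; this file proves it for every `m ≥ 1`, every
finite place `v` of `ℚ` and every target place `w₀`:

* `exists_absGalois_sigma_smul_eq` — `∃ γ : Γ_ℚ, σ_{χ_m(γ)} • w = w₀` for any two places `w, w₀` of
  `ℚ(ζ_m)` above the same `v` (transitivity of `Gal(ℚ(ζ_m)/ℚ)` on the fibre, Cassels–Fröhlich VII Prop. 1.2 (ii)
  = the tree's `HeightOneSpectrum.exists_algEquiv_smul_eq`; every automorphism is a `σ_b`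
  (`IsCyclotomicExtension.autEquivPow`); `χ_m : Γ_ℚ → (ℤ/m)ˣ` is onto, the tree's
  `modNCyclotomicCharacter_rat_surjective`);
* `exists_twistFamily` — the packaged function `g` with the `hg` clause VERBATIM (choice);
* `nonempty_extension_cyclotomicField` — the fibre is nonempty (a target `w₀` exists).

References: J. W. S. Cassels, A. Fröhlich, *Algebraic Number Theory* (1967), Ch. VII §1.1 and Prop. 1.2 (ii)
[CasselsFrohlichANT1967]; K. Kato, Astérisque 295 (2004), (5.7.1) p. 157 [Kato2004Asterisque];
L. Washington, *Introduction to Cyclotomic Fields*, Thm. 2.5 [Washington1997Cyclotomic].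
-/

noncomputable section

-- the cell's Theorems namespace `Summit.BirchSwinnertonDyer.BirchSwinnertonDyer.…` repeats the summit name by design (D-0017)
set_option linter.dupNamespace false

open scoped NumberField
open Field IsDedekindDomain NumberField Polynomial
open Literature.NumberTheory.GaloisRepresentations Literature.NumberTheory.Automorphic
open Literature.NumberTheory.EllipticCurves.Kato2004.EulerSystemValues

namespace Summit.BirchSwinnertonDyer.BirchSwinnertonDyer.Theorems.KimAtThreeFineKatoTwistFamily

variable (m : ℕ) [NeZero m] (v : HeightOneSpectrum (𝓞 ℚ))

set_option backward.isDefEq.respectTransparency false in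
/-- **Every place of `ℚ(ζ_m)` above `v` is moved to any other by some `σ_{χ_m(γ)}`, `γ ∈ Γ_ℚ`**:
`∃ γ, sigma m (χ_m γ) • w = w₀` (transitivity of `Gal(ℚ(ζ_m)/ℚ)` on the places above `v`, every
automorphism being `σ_b` for some `b ∈ (ℤ/m)ˣ`, and surjectivity of the mod-`m` cyclotomic character of `Γ_ℚ`).
[cite: CasselsFrohlichANT1967, Ch. VII Prop. 1.2 (ii)] [cite: Kato2004Asterisque, (5.7.1) (p. 157)] -/
theorem exists_absGalois_sigma_smul_eq (w₀ w : v.Extension (𝓞 (CyclotomicField m ℚ))) :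
    ∃ γ : absoluteGaloisGroup ℚ,
      sigma m (modNCyclotomicCharacter ℚ m γ) • w.1 = w₀.1 := by
  haveI : IsGalois ℚ (CyclotomicField m ℚ) := IsCyclotomicExtension.isGalois {m} ℚ (CyclotomicField m ℚ)
  obtain ⟨σ, hσ⟩ := HeightOneSpectrum.exists_algEquiv_smul_eq (F := ℚ) (E := CyclotomicField m ℚ)
    (w := w.1) (w' := w₀.1) (w.2.trans w₀.2.symm)
  obtain ⟨γ, hγ⟩ := modNCyclotomicCharacter_rat_surjective m
    (IsCyclotomicExtension.autEquivPow (CyclotomicField m ℚ) (cyclotomic.irreducible_rat (NeZero.pos m)) σ)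
  refine ⟨γ, ?_⟩
  rw [hγ, sigma, MulEquiv.symm_apply_apply]
  exact hσ

set_option backward.isDefEq.respectTransparency false in
/-- **The twist family exists**: for every target place `w₀ ∣ v` of `ℚ(ζ_m)` there is a function
`g : (places above v) → Γ_ℚ` with `sigma m (χ_m (g w)) • w = w₀` for all `w` — the `hg` clause of the
single-completion Kato package (hKdef₀ / hKatoV2₀) verbatim at `m := cycLevel 3 k' r`.
[cite: CasselsFrohlichANT1967, Ch. VII Prop. 1.2 (ii)] [cite: Kato2004Asterisque, (5.7.1) (p. 157)] -/
theorem exists_twistFamily (w₀ : v.Extension (𝓞 (CyclotomicField m ℚ))) :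
    ∃ g : v.Extension (𝓞 (CyclotomicField m ℚ)) → absoluteGaloisGroup ℚ,
      ∀ w : v.Extension (𝓞 (CyclotomicField m ℚ)),
        sigma m (modNCyclotomicCharacter ℚ m (g w)) • w.1 = w₀.1 :=
  ⟨fun w => (exists_absGalois_sigma_smul_eq m v w₀ w).choose,
    fun w => (exists_absGalois_sigma_smul_eq m v w₀ w).choose_spec⟩

omit [NeZero m] in
set_option backward.isDefEq.respectTransparency false in
/-- **The fibre is nonempty**: every finite place `v` of `ℚ` has a place `w₀` of `ℚ(ζ_m)` above it
(going-up for the integral extension `𝓞 ℚ(ζ_m) / ℤ`). [cite: CasselsFrohlichANT1967, Ch. VII §1.1] -/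
theorem nonempty_extension_cyclotomicField : Nonempty (v.Extension (𝓞 (CyclotomicField m ℚ))) := by
  haveI := v.isPrime.isMaximal v.ne_bot
  obtain ⟨Q, hQmax, hQ⟩ :=
    Ideal.exists_maximal_ideal_liesOver_of_isIntegral (S := 𝓞 (CyclotomicField m ℚ)) v.asIdeal
  have hQ0 : Q ≠ ⊥ := Ideal.ne_bot_of_liesOver_of_ne_bot v.ne_bot Q
  exact ⟨⟨⟨Q, hQmax.isPrime, hQ0⟩, HeightOneSpectrum.ext hQ.over.symm⟩⟩

set_option backward.isDefEq.respectTransparency false in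
/-- **Twist family with a chosen target**: `∃ w₀ g, ∀ w, sigma m (χ_m (g w)) • w = w₀` — the two leading
existential binders `∃ w₀ g hg` of the single-completion Kato package at once.
[cite: CasselsFrohlichANT1967, Ch. VII Prop. 1.2 (ii)] [cite: Kato2004Asterisque, (5.7.1) (p. 157)] -/
theorem exists_target_twistFamily :
    ∃ (w₀ : v.Extension (𝓞 (CyclotomicField m ℚ)))
      (g : v.Extension (𝓞 (CyclotomicField m ℚ)) → absoluteGaloisGroup ℚ),
      ∀ w : v.Extension (𝓞 (CyclotomicField m ℚ)),
        sigma m (modNCyclotomicCharacter ℚ m (g w)) • w.1 = w₀.1 := by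
  obtain ⟨w₀⟩ := nonempty_extension_cyclotomicField m v
  exact ⟨w₀, exists_twistFamily m v w₀⟩

end Summit.BirchSwinnertonDyer.BirchSwinnertonDyer.Theorems.KimAtThreeFineKatoTwistFamily

end
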